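/-
Copyright: the b2b-balaban T⁴-continuum CRUX team, row NE7b OWNER lineage `t4-ne7b-p1` (gen 136). Project licence.
-/
import Summits.QuantumFields.BalabanUV.T4Continuum.Spine.NE7b.SupBlockUpperLetterTransfer
import Summits.QuantumFields.BalabanUV.T4Continuum.Spine.NE7b.SupBlockEffectiveActionDerivative

/-!
# THE UPPER SECOND-ORDER LETTER OF THE NEXT POTENTIAL FOR A BLOCK-LOCAL INPUT — (316)'s BLOCK TWIN ((397) + (399)): for a `C¹` block
# potential `U` with the two block letters of (399) (stability `−κ₀Σ_Yφ² ≤ U`, gradient `‖U′‖ ≤ κ₁(a+Σ_Yφ²)`) and the UPPER letter along a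
# shift `δ`, `U(φ+δ) ≤ U(φ) + U′(φ)[δ] + c` (e.g. `c = ½Λ·Q(δ)`), over `N(0,Γ)` with `Γ ⪯ γ_op·1` under the regulator margin: at EVERY `ψ`,
#   `W(ψ+δ) ≤ W(ψ) + DW(ψ)[δ] + c`,   `W = −log∫e^{−U(ω+·)}dN(0,Γ)`, `DW(ψ) = fderiv ℝ W ψ`,
# i.e. the tilted mean of (397) IS the derivative of (399).  With (398)∕its Gaussian reading for the lower half, the TWO-SIDED second-order
# class passes through the fluctuation step for BLOCK-local inputs (row NE7b, node U5c; (397)∕(399) BY NAME; [folklore])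

Cell `pub-balaban`, sub-cell `t4`, spine estimate NE7b (`T4WeightBudget.RelWeightBound`; the cell's OWN estimate — NOT PRINTED in
[Bałaban 1983–89], NOT PROVED).  Crux-route work under `Spine/NE7b/` by the row OWNER (`t4-ne7b-p1` gen 136, file (400)) under FREEZE
(0)'s crux-prover clause, on this gen's SCOPING-d8 (β1); NOTHING of Bałaban's is named as a Lean object, valued or asserted; no
`T4Continuum/Support` leaf typed; no `def`, no notation; zero `sorry`.  Imports (BY NAME): the OWNER's (397) `…SupBlockUpperLetterTransfer`
(`block_upper_letter`), (399) `…SupBlockEffectiveActionDerivative` (`hasFDerivAt_block_neg_log`, `integrable_weighted_blockDeriv`,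
`fderiv_block_neg_log_apply`, `integrable_exp_neg_block`).

WHAT IS PROVED ([folklore]):
* §1 `integrable_weighted_blockDeriv_apply` (`e^{−U(ω+ψ)}·U′(ω+ψ)[δ]` is integrable);
* §2 THE END **`block_neg_log_upper_letter`**: `−log Z(ψ+δ) ≤ −log Z(ψ) + (fderiv ℝ (−log Z) ψ) δ + c` at EVERY `ψ`, for every shift `δ`
  along which `U` has the upper letter with constant `c`; `block_neg_log_upper_letter_quadratic` (the road's form `c = ½Λ·Σ_Y δ²` from a
  letter `U(φ′) ≤ U(φ) + U′(φ)[φ′−φ] + ½ΛΣ_Y(φ′−φ)²` for all `φ, φ′`); §3 toy.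

HONEST (what this is NOT).  The upper half on the Gaussian road for block inputs; the lower half's Gaussian reading ((398) is on Lebesgue
`ℝ^σ`) is the next file; no Hessian, no cubic letter for block inputs; scalar skeleton ((A3), NC-NE7b-α UNRULED); nothing of Bałaban's
asserted.  BY-NAME EFFECT ON THE WALL: NONE.  NE7b NOT PRINTED ∕ NOT PROVED; spine PROVED 0∕9; rung (B)+1 — the programme's measures remain
FINITE-torus statements; NOT the mass gap, NOT Clay.  HONEST DEPENDENCY: continuum YM on T⁴ ⇐ BetaPertH ∧ nine spine estimates (0∕9 proved);
BetaPertH ⇐ (D1) ∧ (D4) ∧ CAP+tail; G-an2-4 gates asym, D1 and NE2∕3∕4.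
-/

set_option autoImplicit false

noncomputable section

namespace Summit.QuantumFields.BalabanUV.T4Continuum.NE7b.SupBlockUpperLetter

open MeasureTheory ProbabilityTheory Finset Real
open scoped BigOperators
open SupBlockUpperLetterTransfer (block_upper_letter)
open SupBlockEffectiveActionDerivative (hasFDerivAt_block_neg_log integrable_weighted_blockDeriv fderiv_block_neg_log_apply
  integrable_exp_neg_block)
open SupEffectiveActionDerivative (mul_opBound_le_of_le)

variable {ι : Type} [Fintype ι] [DecidableEq ι]

section Road

variable {Γ : Matrix ι ι ℝ} {γop : ℝ} {U : EuclideanSpace ℝ ι → ℝ} {U' : EuclideanSpace ℝ ι → EuclideanSpace ℝ ι →L[ℝ] ℝ}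
  {κ₀ κ₁ a τ δ θ : ℝ}

/-! ## §1. Integrability of the weighted directional derivative -/

/-- `e^{−U(ω+ψ)}·U′(ω+ψ)[v]` is integrable under `N(0,Γ)`. [folklore] -/
theorem integrable_weighted_blockDeriv_apply (hΓ : Γ.PosSemidef) (hΓop : (γop • (1 : Matrix ι ι ℝ) - Γ).PosSemidef) (Y : Finset ι)
    (hUd : ∀ φ : EuclideanSpace ℝ ι, HasFDerivAt U (U' φ) φ) (hU'c : Continuous U')
    (hκ₀ : 0 ≤ κ₀) (hκ₁ : 0 ≤ κ₁) (ha : 0 ≤ a) (hτ : 0 < τ) (hδ : 0 < δ) (hθ1 : θ < 1)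
    (hκθ : (2 * κ₀ * (1 + τ) + 4 * δ) * γop ≤ θ) (hstab : ∀ φ : EuclideanSpace ℝ ι, -(κ₀ * ∑ x ∈ Y, φ x ^ 2) ≤ U φ)
    (hU'b : ∀ φ : EuclideanSpace ℝ ι, ‖U' φ‖ ≤ κ₁ * (a + ∑ x ∈ Y, φ x ^ 2)) (ψ v : EuclideanSpace ℝ ι) :
    Integrable (fun ω : EuclideanSpace ℝ ι => exp (-U (ω + ψ)) * U' (ω + ψ) v) (multivariateGaussian 0 Γ) := by
  have h := (ContinuousLinearMap.apply ℝ ℝ v).integrable_comp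
    (integrable_weighted_blockDeriv hΓ hΓop Y hUd hU'c hκ₀ hκ₁ ha hτ hδ hθ1 hκθ hstab hU'b ψ)
  refine h.congr (ae_of_all _ fun ω => ?_)
  simp only [ContinuousLinearMap.apply_apply, FunLike.coe_smul, Pi.smul_apply, smul_eq_mul]

/-! ## §2. THE END: the upper letter of the next potential for a block-local input -/

/-- **THE UPPER SECOND-ORDER LETTER OF THE NEXT POTENTIAL FOR A BLOCK-LOCAL INPUT.**  `Γ ⪰ 0`, `Γ ⪯ γ_op·1`; `U` everywhere differentiable
(`HasFDerivAt U (U′ φ) φ`, `U′` continuous) with the two block letters on `Y` and the upper letter along `δ` with constant `c`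
(`U(φ+δ) ≤ U(φ) + U′(φ)[δ] + c` for all `φ`); the regulator margin `(2κ₀(1+τ)+4δ′)γ_op ≤ θ < 1` ⟹ at EVERY `ψ`:
`−log Z(ψ+δ) ≤ −log Z(ψ) + (fderiv ℝ (−log Z) ψ) δ + c`, `Z(ψ) = ∫e^{−U(ω+ψ)}dN(0,Γ)`. [folklore] -/
theorem block_neg_log_upper_letter (hΓ : Γ.PosSemidef) (hΓop : (γop • (1 : Matrix ι ι ℝ) - Γ).PosSemidef) (Y : Finset ι)
    (hUd : ∀ φ : EuclideanSpace ℝ ι, HasFDerivAt U (U' φ) φ) (hU'c : Continuous U')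
    (hκ₀ : 0 ≤ κ₀) (hκ₁ : 0 ≤ κ₁) (ha : 0 ≤ a) (hτ : 0 < τ) (hδ : 0 < δ) (hθ0 : 0 < θ) (hθ1 : θ < 1)
    (hκθ : (2 * κ₀ * (1 + τ) + 4 * δ) * γop ≤ θ) (hstab : ∀ φ : EuclideanSpace ℝ ι, -(κ₀ * ∑ x ∈ Y, φ x ^ 2) ≤ U φ)
    (hU'b : ∀ φ : EuclideanSpace ℝ ι, ‖U' φ‖ ≤ κ₁ * (a + ∑ x ∈ Y, φ x ^ 2)) (v : EuclideanSpace ℝ ι) {c : ℝ}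
    (hup : ∀ φ : EuclideanSpace ℝ ι, U (φ + v) ≤ U φ + U' φ v + c) (ψ : EuclideanSpace ℝ ι) :
    -log (∫ ω : EuclideanSpace ℝ ι, exp (-U (ω + (ψ + v))) ∂(multivariateGaussian 0 Γ)) ≤
      -log (∫ ω : EuclideanSpace ℝ ι, exp (-U (ω + ψ)) ∂(multivariateGaussian 0 Γ)) +
        fderiv ℝ (fun ψ' : EuclideanSpace ℝ ι => -log (∫ ω : EuclideanSpace ℝ ι, exp (-U (ω + ψ')) ∂(multivariateGaussian 0 Γ))) ψ v + c := by
  have hUc : Continuous U := continuous_iff_continuousAt.2 fun φ => (hUd φ).continuousAt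
  have hUm : Measurable U := hUc.measurable
  have hκθ₀ : 2 * κ₀ * (1 + τ) * γop ≤ θ := mul_opBound_le_of_le (by positivity) (by linarith) hθ0.le hκθ
  have hI := integrable_exp_neg_block hΓ hΓop Y hUm hκ₀ hτ hθ1 hκθ₀ hstab ψ
  have hI' := integrable_exp_neg_block hΓ hΓop Y hUm hκ₀ hτ hθ1 hκθ₀ hstab (ψ + v)
  have hID := integrable_weighted_blockDeriv_apply hΓ hΓop Y hUd hU'c hκ₀ hκ₁ ha hτ hδ hθ1 hκθ hstab hU'b ψ v
  have hZ : 0 < ∫ ω : EuclideanSpace ℝ ι, exp (-U (ω + ψ)) ∂(multivariateGaussian 0 Γ) := integral_exp_pos hI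
  have h := (block_upper_letter (μ := multivariateGaussian 0 Γ) U (fun φ => U' φ v) v hup ψ hI hID hI' hZ).2
  rw [(hasFDerivAt_block_neg_log hΓ hΓop Y hUd hU'c hκ₀ hκ₁ ha hτ hδ hθ0 hθ1 hκθ hstab hU'b ψ).fderiv,
    fderiv_block_neg_log_apply hΓ hΓop Y hUd hU'c hκ₀ hκ₁ ha hτ hδ hθ1 hκθ hstab hU'b ψ v, inv_mul_eq_div]
  exact h

/-- **THE ROAD'S FORM**: from the two-point upper letter `U(φ′) ≤ U(φ) + U′(φ)[φ′−φ] + ½Λ·Σ_Y(φ′−φ)²` (all `φ, φ′`), at EVERY `ψ, ψ′`: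
`−log Z(ψ′) ≤ −log Z(ψ) + (fderiv ℝ (−log Z) ψ)(ψ′−ψ) + ½Λ·Σ_Y(ψ′−ψ)²` — (316) verbatim for a BLOCK-local input. [folklore] -/
theorem block_neg_log_upper_letter_quadratic (hΓ : Γ.PosSemidef) (hΓop : (γop • (1 : Matrix ι ι ℝ) - Γ).PosSemidef) (Y : Finset ι)
    (hUd : ∀ φ : EuclideanSpace ℝ ι, HasFDerivAt U (U' φ) φ) (hU'c : Continuous U')
    (hκ₀ : 0 ≤ κ₀) (hκ₁ : 0 ≤ κ₁) (ha : 0 ≤ a) (hτ : 0 < τ) (hδ : 0 < δ) (hθ0 : 0 < θ) (hθ1 : θ < 1)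
    (hκθ : (2 * κ₀ * (1 + τ) + 4 * δ) * γop ≤ θ) (hstab : ∀ φ : EuclideanSpace ℝ ι, -(κ₀ * ∑ x ∈ Y, φ x ^ 2) ≤ U φ)
    (hU'b : ∀ φ : EuclideanSpace ℝ ι, ‖U' φ‖ ≤ κ₁ * (a + ∑ x ∈ Y, φ x ^ 2)) {Λ : ℝ}
    (hwup : ∀ φ φ' : EuclideanSpace ℝ ι, U φ' ≤ U φ + U' φ (φ' - φ) + Λ / 2 * ∑ x ∈ Y, (φ' x - φ x) ^ 2)
    (ψ ψ' : EuclideanSpace ℝ ι) :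
    -log (∫ ω : EuclideanSpace ℝ ι, exp (-U (ω + ψ')) ∂(multivariateGaussian 0 Γ)) ≤
      -log (∫ ω : EuclideanSpace ℝ ι, exp (-U (ω + ψ)) ∂(multivariateGaussian 0 Γ)) +
        fderiv ℝ (fun φ : EuclideanSpace ℝ ι => -log (∫ ω : EuclideanSpace ℝ ι, exp (-U (ω + φ)) ∂(multivariateGaussian 0 Γ))) ψ
          (ψ' - ψ) + Λ / 2 * ∑ x ∈ Y, (ψ' x - ψ x) ^ 2 := by
  have hup : ∀ φ : EuclideanSpace ℝ ι, U (φ + (ψ' - ψ)) ≤ U φ + U' φ (ψ' - ψ) + Λ / 2 * ∑ x ∈ Y, (ψ' x - ψ x) ^ 2 := fun φ => by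
    have h := hwup φ (φ + (ψ' - ψ))
    have e1 : φ + (ψ' - ψ) - φ = ψ' - ψ := add_sub_cancel_left φ _
    rw [e1] at h
    have e2 : ∑ x ∈ Y, ((φ + (ψ' - ψ)) x - φ x) ^ 2 = ∑ x ∈ Y, (ψ' x - ψ x) ^ 2 :=
      Finset.sum_congr rfl fun x _ => by simp
    rw [e2] at h
    exact h
  have h := block_neg_log_upper_letter hΓ hΓop Y hUd hU'c hκ₀ hκ₁ ha hτ hδ hθ0 hθ1 hκθ hstab hU'b (ψ' - ψ) hup ψ
  rwa [add_sub_cancel] at h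

end Road

/-! ## §3. Toy -/

/-- Toy: the two-point upper letter for the zero potential holds with `Λ = 0`. -/
example (Y : Finset ι) (φ φ' : EuclideanSpace ℝ ι) :
    (fun _ : EuclideanSpace ℝ ι => (0 : ℝ)) φ' ≤ (fun _ : EuclideanSpace ℝ ι => (0 : ℝ)) φ +
      (0 : EuclideanSpace ℝ ι →L[ℝ] ℝ) (φ' - φ) + 0 / 2 * ∑ x ∈ Y, (φ' x - φ x) ^ 2 := by
  simp

end Summit.QuantumFields.BalabanUV.T4Continuum.NE7b.SupBlockUpperLetter
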